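import Summits.QuantumFields.YangMills.Theorems.FemtoCutoffLadderFixedLatticeLawOffTubeTruncation
import Summits.QuantumFields.YangMills.Theorems.LuscherReductionRunningReductionLatticeTopLower
import HarnessLib

/-!
# Crux `FixedLatticeLaw` (stmt-QuantumFields-23943 ≡ leaf `FemtoGapFixedLattice`), flat-tube split — K2 `OffTubeSuppression` PROVED

Seat `ym-line-fcl-p3` g2 (2026-08-28; explicit-unit prover of route `FemtoCutoffLadder`).  Rung R2b1 = RECORD-label femto transfer gap: NOT infinite
volume, NOT the Clay mass gap, no summit.

The planner's flat-tube split of FCL's node 23943 (route `FlatTubeReduction`, ym-idea-1 g3; critic idea-crit-4 PASS-WITH-PRICE 02:18Z) is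
`FixedLatticeLaw ⇐ K1 ∧ K2` (glue landed: `fixedLatticeLaw_of_nearFlat_offTube`).  This file PROVES K2 — the verbatim body of
`Theses.FlatTubeReduction.OffTubeSuppression` (stmt-QuantumFields-24721) — and records the payoff:

* §1 `exists_poly_le_exp_rpow` — `C·β^N ≤ exp(β^s/2)` for `β ≥ β₀(C,N,s)` (`s > 0`; `x^M/M! ≤ eˣ` with `M = ⌈(N+1)/s⌉₊`);
* §2 `offTube_smallness` — the BUDGET: for `β ≥ β₀(L,θ)`, `e^{−β·β^{−θ}/2}·c_β^{|E|} ≤ (λ_b³/(8L))·λ₀(β,L)`, from RED's polynomial floor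
  `levelValue_zero_ge_poly` (`λ₀ ≥ e^{−(8|P|+2|E|)}(5⁸(8β+1)¹⁹)^{−2|E|} c_β^{|E|}`) and §1 (`e^{β^{1−θ}/2}` beats `β^{38|E|+1}`);
* §3 ★★ `offTubeSuppression` — K2: for `β ≥ β₀`, every physical `ψ ⊥ Ω` (`Ω > 0` the exact ground state) has a physical `ψ' ⊥ Ω` supported in
  the tube `{S ≤ β^{−θ}}` with `‖ψ'‖² ≤ ‖ψ‖²` and `⟨ψ,K_βψ⟩ ≤ ⟨ψ',K_βψ'⟩ + (λ_b³/L)·λ₀‖ψ‖²` — tail mass (`groundState_offCut_mass_le`) and kernel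
  bound (`abs_qform_le_of_offTube_right`) at `t = δ = λ_b³/(8L)`, then `reorthogonalise` (loss `4(δ+t) = λ_b³/L` exactly);
* the payoff — FCL's node 23943 from K1 = `NearFlatRatioLaw` (stmt-QuantumFields-24720) ALONE — is the two-line cone leaf
  `FemtoCutoffLadderFixedLatticeLawOfNearFlat.lean` (this file stays route-independent: no `Theses` import).

HONEST FRAMING: K1 (XL: degenerate toron-valley Born–Oppenheimer at precision `λ_b²/L`, in print only for `L = 1`) stays OPEN and so does
`FixedLatticeLaw`; K2 was the «M» half.  No definitions, no named facts, no `sorry`.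
-/

set_option autoImplicit false

noncomputable section

open MeasureTheory Real
open Literature.MathematicalPhysics.QuantumFieldTheory hiding SU2
open Literature.MathematicalPhysics.QuantumLattice

namespace Summit.QuantumFields.YangMills.Theorems.FemtoCutoffLadder

open Summit.QuantumFields.YangMills.Theorems.FemtoTransferGap

/-! ## §1 A stretched exponential beats every polynomial -/

/-- `C·β^N ≤ exp(β^s/2)` for all `β ≥ β₀` (some `β₀ ≥ 1`), for every real `C`, natural `N` and `s > 0`: with `M = ⌈(N+1)/s⌉₊`,
`exp(β^s/2) ≥ (β^s/2)^M/M! = β^{sM}/(2^M M!) ≥ β^{N+1}/(2^M M!) ≥ Cβ^N` once `β ≥ C·2^M·M!`. [folklore] -/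
theorem exists_poly_le_exp_rpow (C : ℝ) (N : ℕ) {s : ℝ} (hs : 0 < s) :
    ∃ β0 : ℝ, 1 ≤ β0 ∧ ∀ β : ℝ, β0 ≤ β → C * β ^ N ≤ Real.exp (β ^ s / 2) := by
  obtain ⟨M, hM⟩ : ∃ M : ℕ, ((N : ℝ) + 1) / s ≤ M := ⟨⌈((N : ℝ) + 1) / s⌉₊, Nat.le_ceil _⟩
  have hsM : (N : ℝ) + 1 ≤ s * M := by
    rw [div_le_iff₀ hs] at hM
    linarith
  have hDpos : (0 : ℝ) < 2 ^ M * (M.factorial : ℝ) := by positivity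
  refine ⟨max 1 (C * (2 ^ M * (M.factorial : ℝ))), le_max_left _ _, fun β hβ => ?_⟩
  have hβ1 : 1 ≤ β := (le_max_left _ _).trans hβ
  have hβD : C * (2 ^ M * (M.factorial : ℝ)) ≤ β := (le_max_right _ _).trans hβ
  have hβpos : 0 < β := by linarith
  have h1 : (β ^ s / 2) ^ M / (M.factorial : ℝ) ≤ Real.exp (β ^ s / 2) :=
    Real.pow_div_factorial_le_exp (β ^ s / 2) (by positivity) M
  have h2 : (β ^ s / 2) ^ M / (M.factorial : ℝ) = β ^ (s * M) / (2 ^ M * (M.factorial : ℝ)) := by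
    rw [div_pow, ← Real.rpow_natCast (β ^ s) M, ← Real.rpow_mul hβpos.le, div_div]
  have h3 : β ^ ((N : ℝ) + 1) ≤ β ^ (s * M) := Real.rpow_le_rpow_of_exponent_le hβ1 hsM
  have h4 : β ^ ((N : ℝ) + 1) = β ^ N * β := by
    rw [Real.rpow_add hβpos, Real.rpow_natCast, Real.rpow_one]
  have hβN : 0 ≤ β ^ N := by positivity
  have h5 : C * β ^ N ≤ β ^ N * β / (2 ^ M * (M.factorial : ℝ)) := by
    rw [le_div_iff₀ hDpos]
    calc C * β ^ N * (2 ^ M * (M.factorial : ℝ)) = (C * (2 ^ M * (M.factorial : ℝ))) * β ^ N := by ring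
      _ ≤ β * β ^ N := mul_le_mul_of_nonneg_right hβD hβN
      _ = β ^ N * β := by ring
  calc C * β ^ N ≤ β ^ N * β / (2 ^ M * (M.factorial : ℝ)) := h5
    _ = β ^ ((N : ℝ) + 1) / (2 ^ M * (M.factorial : ℝ)) := by rw [h4]
    _ ≤ β ^ (s * M) / (2 ^ M * (M.factorial : ℝ)) := div_le_div_of_nonneg_right h3 hDpos.le
    _ = (β ^ s / 2) ^ M / (M.factorial : ℝ) := h2.symm
    _ ≤ Real.exp (β ^ s / 2) := h1

/-! ## §2 The smallness budget from the polynomial floor -/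

/-- `λ_b(β)³ = 2/β` (`β > 0`). [cite: Luscher1983, §2] -/
theorem bareLambda_pow_three_eq {β : ℝ} (hβ : 0 < β) : bareLambda β ^ 3 = 2 / β := by
  have h := bareLambda_cube hβ
  field_simp
  linarith

/-- ★ **The budget.**  For every `L` and `θ ∈ (0,1)` there is `β₀ ≥ 1` with
`e^{−β·β^{−θ}/2} · c_β^{|E|} ≤ (λ_b³/(8L)) · λ₀(β,L)` for all `β ≥ β₀`: RED's polynomial floor `λ₀ ≥ e^{−(8|P|+2|E|)}(5⁸(8β+1)¹⁹)^{−2|E|}c_β^{|E|}`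
(`levelValue_zero_ge_poly`) against the stretched exponential `e^{β^{1−θ}/2} ≥ 4βL·e^{8|P|+2|E|}(5⁸·9¹⁹)^{2|E|}β^{38|E|}` (§1).
[cite: Luscher1983, §2] [cite: Balaban1989LargeFieldII, p.355] -/
theorem offTube_smallness (L : ℕ) [NeZero L] {θ : ℝ} (hθ0 : 0 < θ) (hθ1 : θ < 1) :
    ∃ β0 : ℝ, 1 ≤ β0 ∧ ∀ β : ℝ, β0 ≤ β →
      Real.exp (-(β * β ^ (-θ) / 2)) * latCE L β ≤ bareLambda β ^ 3 / (8 * L) * topValue su2Rep L β := by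
  obtain ⟨β0, hβ0, hA⟩ := exists_poly_le_exp_rpow
    (4 * L * (Real.exp (8 * (Fintype.card (Plaquette 3 L) : ℝ) + 2 * Fintype.card (Edge 3 L)) *
      ((5 : ℝ) ^ 8 * 9 ^ 19) ^ (2 * Fintype.card (Edge 3 L))))
    (38 * Fintype.card (Edge 3 L) + 1) (s := 1 - θ) (by linarith)
  refine ⟨β0, hβ0, fun β hβ => ?_⟩
  have hβ1 : 1 ≤ β := hβ0.trans hβ
  have hβpos : 0 < β := by linarith
  have hLpos : (0 : ℝ) < L := by exact_mod_cast NeZero.pos L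
  have hθ' : 0 < 1 - θ := by linarith
  -- RED's polynomial floor
  have hfloor := levelValue_zero_ge_poly (L := L) hβ1
  rw [levelValue_zero] at hfloor
  -- the inverse floor factor `G` and its polynomial bound
  have hGpos : 0 < Real.exp (8 * (Fintype.card (Plaquette 3 L) : ℝ) + 2 * Fintype.card (Edge 3 L)) *
      ((5 : ℝ) ^ 8 * (8 * β + 1) ^ 19) ^ (2 * Fintype.card (Edge 3 L)) := by positivity
  have hpoly : ((5 : ℝ) ^ 8 * (8 * β + 1) ^ 19) ^ (2 * Fintype.card (Edge 3 L)) ≤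
      ((5 : ℝ) ^ 8 * 9 ^ 19) ^ (2 * Fintype.card (Edge 3 L)) * β ^ (38 * Fintype.card (Edge 3 L)) := by
    have h1 : (8 * β + 1) ^ 19 ≤ (9 * β) ^ 19 := pow_le_pow_left₀ (by positivity) (by linarith) 19
    calc ((5 : ℝ) ^ 8 * (8 * β + 1) ^ 19) ^ (2 * Fintype.card (Edge 3 L))
        ≤ ((5 : ℝ) ^ 8 * (9 * β) ^ 19) ^ (2 * Fintype.card (Edge 3 L)) :=
          pow_le_pow_left₀ (by positivity) (mul_le_mul_of_nonneg_left h1 (by positivity)) _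
      _ = ((5 : ℝ) ^ 8 * 9 ^ 19) ^ (2 * Fintype.card (Edge 3 L)) * β ^ (38 * Fintype.card (Edge 3 L)) := by
          rw [mul_pow (9 : ℝ) β 19, ← mul_assoc, mul_pow, ← pow_mul]
          ring_nf
  have hkey : 4 * β * L * (Real.exp (8 * (Fintype.card (Plaquette 3 L) : ℝ) + 2 * Fintype.card (Edge 3 L)) *
      ((5 : ℝ) ^ 8 * (8 * β + 1) ^ 19) ^ (2 * Fintype.card (Edge 3 L))) ≤ Real.exp (β ^ (1 - θ) / 2) := by
    refine le_trans ?_ (hA β hβ)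
    have hc : 0 ≤ 4 * (L : ℝ) * Real.exp (8 * (Fintype.card (Plaquette 3 L) : ℝ) + 2 * Fintype.card (Edge 3 L)) := by
      positivity
    calc 4 * β * L * (Real.exp (8 * (Fintype.card (Plaquette 3 L) : ℝ) + 2 * Fintype.card (Edge 3 L)) *
          ((5 : ℝ) ^ 8 * (8 * β + 1) ^ 19) ^ (2 * Fintype.card (Edge 3 L)))
        = 4 * L * Real.exp (8 * (Fintype.card (Plaquette 3 L) : ℝ) + 2 * Fintype.card (Edge 3 L)) *
            ((5 : ℝ) ^ 8 * (8 * β + 1) ^ 19) ^ (2 * Fintype.card (Edge 3 L)) * β := by ring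
      _ ≤ 4 * L * Real.exp (8 * (Fintype.card (Plaquette 3 L) : ℝ) + 2 * Fintype.card (Edge 3 L)) *
            (((5 : ℝ) ^ 8 * 9 ^ 19) ^ (2 * Fintype.card (Edge 3 L)) * β ^ (38 * Fintype.card (Edge 3 L))) * β :=
          mul_le_mul_of_nonneg_right (mul_le_mul_of_nonneg_left hpoly hc) hβpos.le
      _ = 4 * L * (Real.exp (8 * (Fintype.card (Plaquette 3 L) : ℝ) + 2 * Fintype.card (Edge 3 L)) *
            ((5 : ℝ) ^ 8 * 9 ^ 19) ^ (2 * Fintype.card (Edge 3 L))) * β ^ (38 * Fintype.card (Edge 3 L) + 1) := by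
          rw [pow_succ]; ring
  -- `F · G = 1` for the floor factor `F`
  have hFG : Real.exp (-(8 * (Fintype.card (Plaquette 3 L) : ℝ) + 2 * Fintype.card (Edge 3 L))) *
      (((5 : ℝ) ^ 8 * (8 * β + 1) ^ 19)⁻¹) ^ (2 * Fintype.card (Edge 3 L)) *
      (Real.exp (8 * (Fintype.card (Plaquette 3 L) : ℝ) + 2 * Fintype.card (Edge 3 L)) *
        ((5 : ℝ) ^ 8 * (8 * β + 1) ^ 19) ^ (2 * Fintype.card (Edge 3 L))) = 1 := by
    have hb : (0 : ℝ) < ((5 : ℝ) ^ 8 * (8 * β + 1) ^ 19) ^ (2 * Fintype.card (Edge 3 L)) := by positivity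
    rw [inv_pow, Real.exp_neg]
    field_simp
  -- exponent bookkeeping
  have hexp : β * β ^ (-θ) = β ^ (1 - θ) := by
    rw [sub_eq_add_neg, Real.rpow_add hβpos, Real.rpow_one]
  have hee : Real.exp (-(β ^ (1 - θ) / 2)) * Real.exp (β ^ (1 - θ) / 2) = 1 := by
    rw [← Real.exp_add, neg_add_cancel, Real.exp_zero]
  have hCE : 0 < latCE L β := latCE_pos hβpos.le
  rw [hexp, bareLambda_pow_three_eq hβpos]
  -- `e · c_β^{|E|} · 4βL ≤ λ₀`
  have h3 : Real.exp (-(β ^ (1 - θ) / 2)) * latCE L β * (4 * β * L) ≤ topValue su2Rep L β := by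
    have hle1 : Real.exp (-(β ^ (1 - θ) / 2)) *
        (4 * β * L * (Real.exp (8 * (Fintype.card (Plaquette 3 L) : ℝ) + 2 * Fintype.card (Edge 3 L)) *
          ((5 : ℝ) ^ 8 * (8 * β + 1) ^ 19) ^ (2 * Fintype.card (Edge 3 L)))) ≤ 1 := by
      calc _ ≤ Real.exp (-(β ^ (1 - θ) / 2)) * Real.exp (β ^ (1 - θ) / 2) :=
            mul_le_mul_of_nonneg_left hkey (Real.exp_pos _).le
        _ = 1 := hee
    have hFnn : 0 ≤ Real.exp (-(8 * (Fintype.card (Plaquette 3 L) : ℝ) + 2 * Fintype.card (Edge 3 L))) *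
        (((5 : ℝ) ^ 8 * (8 * β + 1) ^ 19)⁻¹) ^ (2 * Fintype.card (Edge 3 L)) * latCE L β :=
      mul_nonneg (by positivity) hCE.le
    calc Real.exp (-(β ^ (1 - θ) / 2)) * latCE L β * (4 * β * L)
        = (Real.exp (-(β ^ (1 - θ) / 2)) *
            (4 * β * L * (Real.exp (8 * (Fintype.card (Plaquette 3 L) : ℝ) + 2 * Fintype.card (Edge 3 L)) *
              ((5 : ℝ) ^ 8 * (8 * β + 1) ^ 19) ^ (2 * Fintype.card (Edge 3 L))))) *
          (Real.exp (-(8 * (Fintype.card (Plaquette 3 L) : ℝ) + 2 * Fintype.card (Edge 3 L))) *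
            (((5 : ℝ) ^ 8 * (8 * β + 1) ^ 19)⁻¹) ^ (2 * Fintype.card (Edge 3 L)) * latCE L β) := by
          rw [show (Real.exp (-(β ^ (1 - θ) / 2)) *
              (4 * β * L * (Real.exp (8 * (Fintype.card (Plaquette 3 L) : ℝ) + 2 * Fintype.card (Edge 3 L)) *
                ((5 : ℝ) ^ 8 * (8 * β + 1) ^ 19) ^ (2 * Fintype.card (Edge 3 L))))) *
              (Real.exp (-(8 * (Fintype.card (Plaquette 3 L) : ℝ) + 2 * Fintype.card (Edge 3 L))) *
                (((5 : ℝ) ^ 8 * (8 * β + 1) ^ 19)⁻¹) ^ (2 * Fintype.card (Edge 3 L)) * latCE L β)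
              = Real.exp (-(β ^ (1 - θ) / 2)) * latCE L β * (4 * β * L) *
                (Real.exp (-(8 * (Fintype.card (Plaquette 3 L) : ℝ) + 2 * Fintype.card (Edge 3 L))) *
                  (((5 : ℝ) ^ 8 * (8 * β + 1) ^ 19)⁻¹) ^ (2 * Fintype.card (Edge 3 L)) *
                  (Real.exp (8 * (Fintype.card (Plaquette 3 L) : ℝ) + 2 * Fintype.card (Edge 3 L)) *
                    ((5 : ℝ) ^ 8 * (8 * β + 1) ^ 19) ^ (2 * Fintype.card (Edge 3 L)))) by ring,
            hFG, mul_one]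
      _ ≤ 1 * topValue su2Rep L β := mul_le_mul hle1 hfloor hFnn zero_le_one
      _ = topValue su2Rep L β := one_mul _
  have h4 : 2 / β / (8 * (L : ℝ)) * topValue su2Rep L β = topValue su2Rep L β / (4 * β * L) := by
    field_simp
    ring
  rw [h4, le_div_iff₀ (by positivity)]
  exact h3

/-! ## §3 K2: off-tube suppression -/

/-- ★★ **K2 = `OffTubeSuppression` (the verbatim body of `Theses.FlatTubeReduction.OffTubeSuppression`, stmt-QuantumFields-24721), PROVED.**
For every `L` and `θ ∈ (0,1)` there is `β₀` such that for `β ≥ β₀`, every exact positive physical ground state `Ω` (`K_βΩ = λ₀Ω`) and every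
physical `ψ ⊥ Ω` admit a physical `ψ' ⊥ Ω` supported in the tube `{S ≤ β^{−θ}}` with `‖ψ'‖² ≤ ‖ψ‖²` and
`⟨ψ,K_βψ⟩ ≤ ⟨ψ',K_βψ'⟩ + (λ_b³/L)·λ₀·‖ψ‖²` — tail mass and off-tube kernel bound at `t = δ = λ_b³/(8L)` (`offTube_smallness`), then
`reorthogonalise`. [cite: ReedSimonIV1978, Thm. XIII.1] [cite: SeilerLNP1982, §3] -/
theorem offTubeSuppression :
    ∀ (L : ℕ) [NeZero L] (θ : ℝ), 0 < θ → θ < 1 → ∃ β0 : ℝ, ∀ β : ℝ, β0 ≤ β →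
      ∀ (Ω ψ : Literature.MathematicalPhysics.QuantumFieldTheory.GaugeConfig 3 L SU2 → ℝ), IsPhys Ω → (∀ U, 0 < Ω U) →
        transferApply β Ω = topValue su2Rep L β • Ω → IsPhys ψ → l2 ψ Ω = 0 →
          ∃ ψ' : Literature.MathematicalPhysics.QuantumFieldTheory.GaugeConfig 3 L SU2 → ℝ, IsPhys ψ' ∧ l2 ψ' Ω = 0 ∧
            (∀ U, β ^ (-θ) < Literature.MathematicalPhysics.QuantumFieldTheory.wilsonAction su2Rep U → ψ' U = 0) ∧
            l2 ψ' ψ' ≤ l2 ψ ψ ∧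
            qform su2Rep β ψ ψ ≤ qform su2Rep β ψ' ψ' + bareLambda β ^ 3 / L * topValue su2Rep L β * l2 ψ ψ := by
  intro L _ θ hθ0 hθ1
  obtain ⟨β0, hβ0, hsmall⟩ := offTube_smallness L hθ0 hθ1
  refine ⟨β0, fun β hβ Ω ψ hΩ _hΩpos heig hψ horth => ?_⟩
  have hβ1 : 1 ≤ β := hβ0.trans hβ
  have hβpos : 0 < β := by linarith
  have hLpos : (0 : ℝ) < L := by exact_mod_cast NeZero.pos L
  have hL1 : (1 : ℝ) ≤ L := by exact_mod_cast NeZero.one_le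
  have hl3 : bareLambda β ^ 3 = 2 / β := bareLambda_pow_three_eq hβpos
  have hlam : 0 < topValue su2Rep L β := topValue_su2Rep_pos L β
  have hδ0 : 0 < bareLambda β ^ 3 / (8 * L) := by rw [hl3]; positivity
  have hδhalf : bareLambda β ^ 3 / (8 * L) ≤ 1 / 2 := by
    rw [hl3, div_div, div_le_iff₀ (by positivity)]
    nlinarith
  have hε : Real.exp (-(β * β ^ (-θ) / 2)) * latCE L β ≤ bareLambda β ^ 3 / (8 * L) * topValue su2Rep L β := hsmall β hβ
  have hε' : Real.exp (-(β * β ^ (-θ) / 2)) * latCE L β ≤ topValue su2Rep L β :=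
    hε.trans (mul_le_of_le_one_left hlam.le (by linarith))
  -- tail mass
  have htail : l2 (fun U => if β ^ (-θ) < wilsonAction su2Rep U then Ω U else 0)
      (fun U => if β ^ (-θ) < wilsonAction su2Rep U then Ω U else 0) ≤ bareLambda β ^ 3 / (8 * L) * l2 Ω Ω := by
    refine (groundState_offCut_mass_le (η := β ^ (-θ)) hβpos.le hΩ heig hε').trans
      (mul_le_mul_of_nonneg_right ?_ (l2_self_nonneg _))
    rw [div_le_iff₀ hlam]
    exact hε
  -- off-tube kernel bound
  have hker : ∀ f φ : GaugeConfig 3 L SU2 → ℝ, IsPhys f → IsPhys φ → (∀ U, φ U ≠ 0 → β ^ (-θ) < wilsonAction su2Rep U) →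
      |qform su2Rep β f φ| ≤ bareLambda β ^ 3 / (8 * L) * topValue su2Rep L β * (l2 f f + l2 φ φ) / 2 := by
    intro f φ hf hφ hφs
    refine (abs_qform_le_of_offTube_right hβpos.le hf hφ hφs).trans ?_
    have hnn : 0 ≤ l2 f f + l2 φ φ := add_nonneg (l2_self_nonneg _) (l2_self_nonneg _)
    exact div_le_div_of_nonneg_right (mul_le_mul_of_nonneg_right hε hnn) (by norm_num)
  obtain ⟨ψ', hψ', horth', hsupp', hle', hq⟩ :=
    reorthogonalise hβpos.le hδ0.le hδhalf hδ0.le hΩ hψ heig horth htail hker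
  refine ⟨ψ', hψ', horth', hsupp', hle', hq.trans (le_of_eq ?_)⟩
  have h8 : 4 * (bareLambda β ^ 3 / (8 * L) + bareLambda β ^ 3 / (8 * L)) = bareLambda β ^ 3 / L := by
    field_simp
    ring
  rw [h8]

end Summit.QuantumFields.YangMills.Theorems.FemtoCutoffLadder

end
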